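import Literature.Probability.RandomPlanarGeometry.SAWTriangularPolygonSplice
import Literature.Probability.Percolation.TriAnnulusCircuit
import Literature.Probability.RandomPlanarGeometry.HexSAWLattice
import HarnessLib

/-!
# Anchors and gadgets for the walk–polygon insertion on `𝕋` («TRI-SAP-RATIO-RATE», G2ʷ — part 2 of 4)

Topic `Literature/Probability/RandomPlanarGeometry` (lane «pcv-sawmu», routes R82/R83). Source: N. Madras, G. Slade,
*The Self-Avoiding Walk* (1993), §3.2, proof of Theorem 3.2.3 (concatenation of polygons at extremal vertices), as the
insertion input of Theorem 7.4.5 (c) p. 254. On `𝕋 = ℤ²` with the extra edges `±(1,-1)` («rows» = the second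
coordinate; up-steps `(0,1)`, `(-1,1)`, down-steps `(0,-1)`, `(1,-1)`, horizontal `(±1,0)`):

* relative coordinates `pt p a b`, offset adjacency `AdjOff` (`adj_pt_pt_iff` ↔ `triGraph_adj_iff_coord`);
* anchors: **`IsTopLeft ω n j`** (leftmost vertex of the top row of the walk) and **`IsBotLeft lam m r`** (leftmost
  vertex of the bottom row of the polygon), existence, the trichotomies **`IsTopLeft.nbr_cases`** (walk edges at the
  anchor go E, S or SE) and **`IsBotLeft.nbr_cases`** (polygon edges at the corner go E, N or NW), freeness of the rows
  above the walk and of the site West of the anchor, `IsBotLeft.mem_polyPath` (the translated polygon lies weakly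
  above / right of its translated corner);
* **`Gadget`** (connector offsets `c1`, `c2`, path ends `u`, `v`, walk vertices `st`, `en`, corner column `qa`), the
  decidable local condition **`Gadget.Valid`**, the block `Gadget.block`, and the generic law
  **`Gadget.splice_block_mem`**: a valid gadget splices a self-avoiding chain lying in rows `≥ row(p)+2` (corner
  column `≥ col(p)+qa` on that row) into the walk, output in `S_{N+|P|+4}(𝕋)`.
-/

noncomputable section

open Finset Literature.Probability.LatticeModels Literature.Probability.Percolation SimpleGraph
open scoped BigOperators

namespace Literature.Probability.RandomPlanarGeometry.SAW

namespace PolygonInsertion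

/-! ### Relative coordinates -/

/-- The site at offset `(a, b)` from `p` (coordinates of `𝕋 = ℤ²` with the extra diagonal `(1,-1)`).
[cite: MadrasSlade1993, §3.2 (concatenation of polygons)] -/
def pt (p : Site 2) (a b : ℤ) : Site 2 := ![p 0 + a, p 1 + b]

/-- Bookkeeping (`pt_apply_zero`). [cite: MadrasSlade1993, §3.2 (concatenation of polygons; bookkeeping)] -/
@[simp] theorem pt_apply_zero (p : Site 2) (a b : ℤ) : pt p a b 0 = p 0 + a := rfl
/-- Bookkeeping (`pt_apply_one`). [cite: MadrasSlade1993, §3.2 (concatenation of polygons; bookkeeping)] -/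
@[simp] theorem pt_apply_one (p : Site 2) (a b : ℤ) : pt p a b 1 = p 1 + b := rfl

/-- Bookkeeping (`eq_pt`). [cite: MadrasSlade1993, §3.2 (concatenation of polygons; bookkeeping)] -/
theorem eq_pt (p x : Site 2) : x = pt p (x 0 - p 0) (x 1 - p 1) := by
  rw [site_two_eq_iff]; simp

/-- Bookkeeping (`pt_zero_zero`). [cite: MadrasSlade1993, §3.2 (concatenation of polygons; bookkeeping)] -/
@[simp] theorem pt_zero_zero (p : Site 2) : pt p 0 0 = p := by
  rw [site_two_eq_iff]; simp

/-- Bookkeeping (`pt_pt`). [cite: MadrasSlade1993, §3.2 (concatenation of polygons; bookkeeping)] -/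
theorem pt_pt (p : Site 2) (a b c d : ℤ) : pt (pt p a b) c d = pt p (a + c) (b + d) := by
  rw [site_two_eq_iff]; simp [add_assoc]

/-- Bookkeeping (`pt_inj_iff`). [cite: MadrasSlade1993, §3.2 (concatenation of polygons; bookkeeping)] -/
theorem pt_inj_iff (p : Site 2) (a b c d : ℤ) : pt p a b = pt p c d ↔ a = c ∧ b = d := by
  rw [site_two_eq_iff]; simp

/-- Bookkeeping (`pt_add`). [cite: MadrasSlade1993, §3.2 (concatenation of polygons; bookkeeping)] -/
theorem pt_add (p τ : Site 2) (a b : ℤ) : pt p a b + τ = pt (p + τ) a b := by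
  rw [site_two_eq_iff]; simp [add_right_comm]

/-- Adjacency of offsets: the six steps `(±1,0), (0,±1), ±(1,-1)` of `𝕋`. [cite: MadrasSlade1993, §3.2] -/
def AdjOff (o o' : ℤ × ℤ) : Prop :=
  (o'.1 = o.1 + 1 ∧ o'.2 = o.2) ∨ (o.1 = o'.1 + 1 ∧ o'.2 = o.2) ∨ (o'.2 = o.2 + 1 ∧ o'.1 = o.1) ∨
    (o.2 = o'.2 + 1 ∧ o'.1 = o.1) ∨ (o'.1 = o.1 + 1 ∧ o.2 = o'.2 + 1) ∨ (o.1 = o'.1 + 1 ∧ o'.2 = o.2 + 1)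

/-- Bookkeeping (`instance`). [cite: MadrasSlade1993, §3.2 (concatenation of polygons; bookkeeping)] -/
instance : DecidableRel AdjOff := fun _ _ => by unfold AdjOff; infer_instance

/-- Adjacency of two sites given by offsets from a common base. [cite: MadrasSlade1993, §3.2] -/
theorem adj_pt_pt_iff (p : Site 2) (a b c d : ℤ) : triGraph.Adj (pt p a b) (pt p c d) ↔ AdjOff (a, b) (c, d) := by
  rw [triGraph_adj_iff_coord, AdjOff]; simp only [pt_apply_zero, pt_apply_one]; omega

/-- The six neighbours of a site, as offsets. [cite: MadrasSlade1993, §3.2] -/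
theorem adj_pt_iff (p : Site 2) (c d : ℤ) : triGraph.Adj p (pt p c d) ↔ AdjOff (0, 0) (c, d) := by
  rw [← adj_pt_pt_iff, pt_zero_zero]

/-! ### The anchors: top-left vertex of the walk, bottom-left vertex of the polygon -/

/-- `ω_j` is the leftmost vertex of the top row of `(ω_0, …, ω_n)` (rows = second coordinate).
[cite: MadrasSlade1993, §3.2 (concatenation at extremal vertices)] -/
structure IsTopLeft (ω : List (Site 2)) (n j : ℕ) : Prop where
  le : j ≤ n
  row_le : ∀ i ≤ n, (ω.getD i 0) 1 ≤ (ω.getD j 0) 1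
  col_le : ∀ i ≤ n, (ω.getD i 0) 1 = (ω.getD j 0) 1 → (ω.getD j 0) 0 ≤ (ω.getD i 0) 0

/-- `λ_r` is the leftmost vertex of the bottom row of `(λ_0, …, λ_{m-1})`. [cite: MadrasSlade1993, §3.2] -/
structure IsBotLeft (lam : List (Site 2)) (m r : ℕ) : Prop where
  lt : r < m
  row_le : ∀ i < m, (lam.getD r 0) 1 ≤ (lam.getD i 0) 1
  col_le : ∀ i < m, (lam.getD i 0) 1 = (lam.getD r 0) 1 → (lam.getD r 0) 0 ≤ (lam.getD i 0) 0

/-- A top-left vertex exists. [cite: MadrasSlade1993, §3.2] -/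
theorem exists_isTopLeft (ω : List (Site 2)) (n : ℕ) : ∃ j, IsTopLeft ω n j := by
  classical
  obtain ⟨j₀, hj₀, hmax⟩ := (Finset.range (n + 1)).exists_max_image (fun i => (ω.getD i 0) 1)
    ⟨0, by simp⟩
  set T := (Finset.range (n + 1)).filter fun i => (ω.getD i 0) 1 = (ω.getD j₀ 0) 1 with hT
  obtain ⟨j, hj, hmin⟩ := T.exists_min_image (fun i => (ω.getD i 0) 0) ⟨j₀, by simp [hT, hj₀]⟩
  simp only [hT, Finset.mem_filter, Finset.mem_range] at hj hmin
  refine ⟨j, ⟨by omega, fun i hi => ?_, fun i hi he => ?_⟩⟩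
  · rw [hj.2]; exact hmax i (by simp; omega)
  · exact hmin i ⟨by omega, by rw [he, hj.2]⟩

/-- A bottom-left vertex exists. [cite: MadrasSlade1993, §3.2] -/
theorem exists_isBotLeft (lam : List (Site 2)) {m : ℕ} (hm : 0 < m) : ∃ r, IsBotLeft lam m r := by
  classical
  obtain ⟨r₀, hr₀, hmin⟩ := (Finset.range m).exists_min_image (fun i => (lam.getD i 0) 1) ⟨0, by simp; omega⟩
  set T := (Finset.range m).filter fun i => (lam.getD i 0) 1 = (lam.getD r₀ 0) 1 with hT
  obtain ⟨r, hr, hmin'⟩ := T.exists_min_image (fun i => (lam.getD i 0) 0) ⟨r₀, by simp [hT, hr₀]⟩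
  simp only [hT, Finset.mem_filter, Finset.mem_range] at hr hmin'
  refine ⟨r, ⟨hr.1, fun i hi => ?_, fun i hi he => ?_⟩⟩
  · rw [hr.2]; exact hmin i (by simpa using hi)
  · exact hmin' i ⟨hi, by rw [he, hr.2]⟩

variable {n m j r : ℕ} {ω lam : List (Site 2)}

/-- **The walk edges at the top-left vertex** go East, South or South-East. [cite: MadrasSlade1993, §3.2] -/
theorem IsTopLeft.nbr_cases (hT : IsTopLeft ω n j) {i : ℕ} (hi : i ≤ n)
    (hadj : triGraph.Adj (ω.getD j 0) (ω.getD i 0)) :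
    ω.getD i 0 = pt (ω.getD j 0) 1 0 ∨ ω.getD i 0 = pt (ω.getD j 0) 0 (-1) ∨
      ω.getD i 0 = pt (ω.getD j 0) 1 (-1) := by
  have h1 := hT.row_le i hi
  have h2 := hT.col_le i hi
  rw [eq_pt (ω.getD j 0) (ω.getD i 0), adj_pt_iff] at hadj
  rw [eq_pt (ω.getD j 0) (ω.getD i 0), pt_inj_iff, pt_inj_iff, pt_inj_iff]
  unfold AdjOff at hadj
  simp only at hadj
  omega

/-- **The polygon edges at the bottom-left vertex** go East, North or North-West. [cite: MadrasSlade1993, §3.2] -/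
theorem IsBotLeft.nbr_cases (hB : IsBotLeft lam m r) {i : ℕ} (hi : i < m)
    (hadj : triGraph.Adj (lam.getD r 0) (lam.getD i 0)) :
    lam.getD i 0 = pt (lam.getD r 0) 1 0 ∨ lam.getD i 0 = pt (lam.getD r 0) 0 1 ∨
      lam.getD i 0 = pt (lam.getD r 0) (-1) 1 := by
  have h1 := hB.row_le i hi
  have h2 := hB.col_le i hi
  rw [eq_pt (lam.getD r 0) (lam.getD i 0), adj_pt_iff] at hadj
  rw [eq_pt (lam.getD r 0) (lam.getD i 0), pt_inj_iff, pt_inj_iff, pt_inj_iff]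
  unfold AdjOff at hadj
  simp only at hadj
  omega

/-- Sites above the top row are not on the walk. [cite: MadrasSlade1993, §3.2] -/
theorem IsTopLeft.not_mem_of_row_lt (hT : IsTopLeft ω n j) (hl : ω.length = n + 1) {x : Site 2}
    (hx : (ω.getD j 0) 1 < x 1) : x ∉ ω := by
  intro hxm
  obtain ⟨i, hi, rfl⟩ := List.getElem_of_mem hxm
  have := hT.row_le i (by omega)
  rw [List.getElem_eq_getD (0 : Site 2)] at hx
  omega

/-- The site West of the top-left vertex is not on the walk. [cite: MadrasSlade1993, §3.2] -/
theorem IsTopLeft.pt_neg_one_zero_not_mem (hT : IsTopLeft ω n j) (hl : ω.length = n + 1) :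
    pt (ω.getD j 0) (-1) 0 ∉ ω := by
  intro hxm
  obtain ⟨i, hi, e⟩ := List.getElem_of_mem hxm
  rw [List.getElem_eq_getD 0] at e
  have h2 := hT.col_le i (by omega) (by rw [e]; simp)
  rw [e] at h2
  simp at h2

/-- Sites of the translated polygon lie weakly above its translated bottom-left vertex, and to its right on that row.
[cite: MadrasSlade1993, §3.2] -/
theorem IsBotLeft.mem_polyPath (hB : IsBotLeft lam m r) (hl : lam.length = m) (τ : Site 2) {r₀ : ℕ}
    (hr₀ : r₀ < m) (d : Bool) {x : Site 2} (hx : x ∈ polyPath lam τ r₀ d) :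
    (lam.getD r 0 + τ) 1 ≤ x 1 ∧ (x 1 = (lam.getD r 0 + τ) 1 → (lam.getD r 0 + τ) 0 ≤ x 0) := by
  rw [mem_polyPath_iff (by omega)] at hx
  obtain ⟨i, hi, rfl⟩ := hx
  rw [hl] at hi
  simp only [Pi.add_apply, add_le_add_iff_right, add_left_inj]
  exact ⟨hB.row_le i hi, hB.col_le i hi⟩

/-! ### Gadgets: the two connectors of an insertion -/

/-- The data of a gadget: offsets (from the walk anchor `p`) of the first connector `c1`, of the endpoints `u`, `v`
of the inserted polygon path, of the second connector `c2`, and of the two walk vertices `st`, `en` between which the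
block is spliced. [cite: MadrasSlade1993, §3.2 (concatenation of polygons)] -/
structure Gadget where
  /-- first connector -/
  c1 : List (ℤ × ℤ)
  /-- start of the polygon path -/
  u : ℤ × ℤ
  /-- end of the polygon path -/
  v : ℤ × ℤ
  /-- second connector -/
  c2 : List (ℤ × ℤ)
  /-- the walk vertex before the block -/
  st : ℤ × ℤ
  /-- the walk vertex after the block -/
  en : ℤ × ℤ
  /-- column offset of the translated bottom-left polygon vertex (its row offset is `2`) -/
  qa : ℤ

/-- Local validity of a gadget: the connectors are chains glued to `st`, `u`, `v`, `en`; connector sites are pairwise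
distinct, lie in rows `p.row + 1`, `p.row + 2` (and then strictly left of the polygon's bottom-left vertex) or at the
free site `p + (-1, 0)`. [cite: MadrasSlade1993, §3.2] -/
def Gadget.Valid (g : Gadget) : Prop :=
  g.c1 ≠ [] ∧ g.c2 ≠ [] ∧ g.c1.length + g.c2.length = 4 ∧
  AdjOff g.st (g.c1.headD 0) ∧ List.IsChain AdjOff g.c1 ∧ AdjOff (g.c1.getLastD 0) g.u ∧
  AdjOff g.v (g.c2.headD 0) ∧ List.IsChain AdjOff g.c2 ∧ AdjOff (g.c2.getLastD 0) g.en ∧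
  (g.c1 ++ g.c2).Nodup ∧
  ∀ c ∈ g.c1 ++ g.c2, (1 ≤ c.2 ∨ c = (-1, 0)) ∧ c.2 ≤ 2 ∧ (c.2 = 2 → c.1 < g.qa)

/-- Bookkeeping (`instance`). [cite: MadrasSlade1993, §3.2 (concatenation of polygons; bookkeeping)] -/
instance (g : Gadget) : Decidable g.Valid := by unfold Gadget.Valid; infer_instance

/-- The block of a gadget around the polygon path `P`. [cite: MadrasSlade1993, §3.2] -/
def Gadget.block (g : Gadget) (p : Site 2) (P : List (Site 2)) : List (Site 2) :=
  g.c1.map (fun c => pt p c.1 c.2) ++ P ++ g.c2.map (fun c => pt p c.1 c.2)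

/-- Bookkeeping (`isChain_map_pt`). [cite: MadrasSlade1993, §3.2 (concatenation of polygons; bookkeeping)] -/
theorem isChain_map_pt {p : Site 2} {l : List (ℤ × ℤ)} (h : List.IsChain AdjOff l) :
    List.IsChain triGraph.Adj (l.map fun c => pt p c.1 c.2) := by
  rw [List.isChain_map]
  exact h.imp fun a b hab => (adj_pt_pt_iff p a.1 a.2 b.1 b.2).2 hab

/-- Bookkeeping (`head?_map_pt`). [cite: MadrasSlade1993, §3.2 (concatenation of polygons; bookkeeping)] -/
theorem head?_map_pt {p : Site 2} {l : List (ℤ × ℤ)} (h : l ≠ []) :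
    (l.map fun c => pt p c.1 c.2).head? = some (pt p (l.headD 0).1 (l.headD 0).2) := by
  obtain ⟨a, t, rfl⟩ := List.exists_cons_of_ne_nil h
  simp

/-- Bookkeeping (`getLast?_map_pt`). [cite: MadrasSlade1993, §3.2 (concatenation of polygons; bookkeeping)] -/
theorem getLast?_map_pt {p : Site 2} {l : List (ℤ × ℤ)} (h : l ≠ []) :
    (l.map fun c => pt p c.1 c.2).getLast? = some (pt p (l.getLastD 0).1 (l.getLastD 0).2) := by
  rw [List.getLast?_eq_getLast_of_ne_nil (by simpa using h), List.getLast_map, Option.some_inj,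
    List.getLastD_eq_getLast?, List.getLast?_eq_getLast_of_ne_nil h, Option.getD_some]

/-- **The gadget block splices into the walk.** Given a valid gadget, a walk `ω ∈ S_N` with top-left vertex
`p = ω_j`, consecutive walk vertices `ω_s = p + st`, `ω_{s+1} = p + en`, and a self-avoiding chain `P` (the translated
polygon, minus one edge) from `p + u` to `p + v` all of whose sites lie in rows `≥ p.row + 2`, those in row `p.row + 2`
having column `≥ p.col + qa`: the spliced list is a self-avoiding walk of length `N + |P| + 4`.
[cite: MadrasSlade1993, §3.2 (concatenation of polygons)] -/
theorem Gadget.splice_block_mem {g : Gadget} (hg : g.Valid) {N s j : ℕ} {ω P : List (Site 2)} (hω : ω ∈ triSL N)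
    (hT : IsTopLeft ω N j) (hsN : s + 1 ≤ N) (hst : ω.getD s 0 = pt (ω.getD j 0) g.st.1 g.st.2)
    (hen : ω.getD (s + 1) 0 = pt (ω.getD j 0) g.en.1 g.en.2) (hPc : List.IsChain triGraph.Adj P) (hPn : P.Nodup)
    (hPu : P.head? = some (pt (ω.getD j 0) g.u.1 g.u.2)) (hPv : P.getLast? = some (pt (ω.getD j 0) g.v.1 g.v.2))
    (hPhigh : ∀ x ∈ P, (ω.getD j 0) 1 + 2 ≤ x 1 ∧ (x 1 = (ω.getD j 0) 1 + 2 → (ω.getD j 0) 0 + g.qa ≤ x 0)) :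
    splice s (g.block (ω.getD j 0) P) ω ∈ triSL (N + (P.length + 4)) := by
  set p := ω.getD j 0 with hp
  have hl := length_of_mem_triSL hω
  obtain ⟨h1, h2, hlen, hst', hc1, hu, hv, hc2, hen', hnd, hsites⟩ := hg
  have hLen : (g.block p P).length = P.length + 4 := by
    simp only [Gadget.block, List.length_append, List.length_map]; omega
  rw [← hLen]
  have hCfree : ∀ c ∈ g.c1 ++ g.c2, pt p c.1 c.2 ∉ ω := by
    intro c hc
    obtain ⟨hc1', -, -⟩ := hsites c hc
    rcases hc1' with hc1' | rfl
    · exact hT.not_mem_of_row_lt hl (by rw [← hp]; simp only [pt_apply_one]; omega)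
    · exact hT.pt_neg_one_zero_not_mem hl
  have hCP : ∀ c ∈ g.c1 ++ g.c2, pt p c.1 c.2 ∉ P := by
    intro c hc hcP
    obtain ⟨hlo, hhi, hrow⟩ := hsites c hc
    obtain ⟨hP1, hP2⟩ := hPhigh _ hcP
    simp only [pt_apply_one, pt_apply_zero, add_le_add_iff_left, add_right_inj] at hP1 hP2
    have hc2 : c.2 = 2 := le_antisymm hhi hP1
    have := hP2 hc2
    have := hrow hc2
    omega
  have hinj : ∀ l : List (ℤ × ℤ), l.Nodup → (l.map fun c => pt p c.1 c.2).Nodup := fun l hl' =>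
    hl'.map_on fun a _ b _ e => by rw [pt_inj_iff] at e; exact Prod.ext e.1 e.2
  refine splice_mem_triSL hω hsN ?_ ?_ ?_ ?_ ?_ ?_ ?_ (a := pt p (g.c1.headD 0).1 (g.c1.headD 0).2)
    (z := pt p (g.c2.getLastD 0).1 (g.c2.getLastD 0).2)
  · -- chain
    simp only [Gadget.block]
    refine List.isChain_append.2 ⟨List.isChain_append.2 ⟨isChain_map_pt hc1, hPc, ?_⟩, isChain_map_pt hc2, ?_⟩
    · intro x hx y hy
      rw [getLast?_map_pt h1, Option.mem_def, Option.some_inj] at hx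
      rw [hPu, Option.mem_def, Option.some_inj] at hy
      subst hx; subst hy
      exact (adj_pt_pt_iff p _ _ _ _).2 hu
    · intro x hx y hy
      rw [List.getLast?_append, head?_map_pt h2] at *
      rw [hPv, Option.some_or, Option.mem_def, Option.some_inj] at hx
      rw [Option.mem_def, Option.some_inj] at hy
      subst hx; subst hy
      exact (adj_pt_pt_iff p _ _ _ _).2 hv
  · -- nodup
    have hn1 : (g.c1.map fun c => pt p c.1 c.2).Nodup := hinj _ (List.nodup_append'.1 hnd).1
    have hn2 : (g.c2.map fun c => pt p c.1 c.2).Nodup := hinj _ (List.nodup_append'.1 hnd).2.1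
    have hd12 := (List.nodup_append'.1 hnd).2.2
    simp only [Gadget.block]
    refine List.nodup_append'.2 ⟨List.nodup_append'.2 ⟨hn1, hPn, ?_⟩, hn2, ?_⟩
    · intro x hx1 hxP
      obtain ⟨c, hc, rfl⟩ := List.mem_map.1 hx1
      exact hCP c (List.mem_append.2 (Or.inl hc)) hxP
    · intro x hx hx2
      obtain ⟨c', hc', rfl⟩ := List.mem_map.1 hx2
      rcases List.mem_append.1 hx with hx1 | hxP
      · obtain ⟨c, hc, e⟩ := List.mem_map.1 hx1
        rw [pt_inj_iff] at e
        have : c = c' := Prod.ext e.1 e.2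
        subst this
        exact hd12 hc hc'
      · exact hCP c' (List.mem_append.2 (Or.inr hc')) hxP
  · -- disjoint from ω
    simp only [Gadget.block, List.mem_append, List.mem_map]
    rintro x ((⟨c, hc, rfl⟩ | hx) | ⟨c, hc, rfl⟩)
    · exact hCfree c (List.mem_append.2 (Or.inl hc))
    · exact hT.not_mem_of_row_lt hl (by have := (hPhigh x hx).1; rw [← hp]; omega)
    · exact hCfree c (List.mem_append.2 (Or.inr hc))
  · simp only [Gadget.block, List.append_assoc, List.head?_append, head?_map_pt h1, Option.some_or]
  · rw [hst]; exact (adj_pt_pt_iff p _ _ _ _).2 hst'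
  · simp only [Gadget.block, List.getLast?_append, getLast?_map_pt h2, Option.some_or]
  · rw [hen]; exact (adj_pt_pt_iff p _ _ _ _).2 hen'

end PolygonInsertion

end Literature.Probability.RandomPlanarGeometry.SAW
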